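import Literature.Analysis.Complex.LengthArea
import Mathlib.MeasureTheory.Measure.Lebesgue.VolumeOfBalls
import Mathlib.Analysis.Complex.UpperHalfPlane.Basic
import HarnessLib

/-!
# A uniform modulus of continuity for conformal maps onto the half-plane (length–area)

Trunk T-STOCH support (complex analysis). Let `g : U → ℍ` be a conformal bijection of an open
set `U ⊆ ℂ` onto the open upper half-plane `ℍ = {im > 0}`, with inverse `f`, which moves points
by a bounded amount: `‖g z - z‖ ≤ C₀` on `U`. (The maps `g_A : ℍ ∖ A → ℍ` of half-plane hulls
`A` with the hydrodynamic normalisation are such, with `C₀ = 3 rad(A)`: G. F. Lawler,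
*Conformally Invariant Processes in the Plane* (2005), (3.12).) We prove the **uniform modulus
of continuity**

  `‖g z₁ - g z₂‖ ≤ 8π (1 + C₀) / √(log (1/d))`

for any two points `z₁, z₂` of a (pre)connected set `Q ⊆ U` of diameter `< d < 1` (precisely
`Q ⊆ B(p, d)`) — `Literature.Analysis.Complex.LengthArea.norm_sub_le_of_isPreconnected`. The
point is that the bound depends on `g` only through `C₀`; for the maps `g_A` this is a
(logarithmically weaker, but purely function-theoretic) substitute for Lawler's estimate (3.21),
Prop. 3.82 — `diam g_A(γ(0,1]) ≤ c √(diam γ · sup im γ)` for a curve `γ` in `ℍ ∖ A`, proved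
there with the Beurling estimate for Brownian motion — which is what makes the driving function
of a slit continuous (Lawler (2005), Lemma 4.1, Lemma 4.2, Prop. 4.4).

## Proof (Wolff's length–area argument plus a projection trick)

1. Length–area (Pommerenke, *Boundary Behaviour of Conformal Maps* (1992), Prop. 2.2, which is
   stated there for an arbitrary open set `H` and centre `c`; `lintegral_angLenAt_sq_le` is its
   display (6) and `exists_mem_Ioo_mul_le` its display (4); the tree's
   `Literature/Analysis/Complex/LengthArea.lean` is the unit-disc case, whose `sqDer`, `der`,
   `angSq`, `angLen` are the specialisations `U = 𝔻` of `sqDerOn`, `derOn`, `angSqAt`, `angLenAt`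
   below up to the parametrisation of the circles — a later pass may fold them into these): with
   `ℓ(ρ)` the total length of
   `Γ_ρ = g(U ∩ {|z - p| = ρ})`, `∫ ℓ(ρ)² dρ/ρ ≤ 2π area g(U ∩ B(p, 1)) ≤ 2π · π(1 + C₀)²`; since
   `∫_d^{√d} dρ/ρ = ½ log(1/d)`, some `ρ ∈ (d, √d)` has `ℓ(ρ) ≤ c := √(4(K+1)/log(1/d))`,
   `K = 2π · area` (`exists_mem_Ioo_mul_le`).
2. The orthogonal projections of `Γ_ρ` to the two axes have Lebesgue measure `≤ ℓ(ρ)` (the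
   change-of-variables inequality `addHaar_image_le_lintegral_abs_det_fderiv` of Mathlib for the
   real functions `t ↦ re g(p + ρe^{it})`, `im g(p + ρe^{it})`).
3. *Projection trick* (`re_mem_image_of_mem`): for `w = g q`, `q ∈ Q`, the number `re w` lies in
   `re(Γ_ρ)`. Otherwise the vertical segment from `w` to `w + iH` misses `Γ_ρ`; its image under
   `f` is a path in `U` from `q ∈ B(p, d)` to `f(w + iH)`, which is far from `p` for large `H`
   (`‖f w' - w'‖ ≤ C₀`), so it crosses the circle `{|z - p| = ρ}` at a point of `U`, whose
   `g`-image is a point of `Γ_ρ` on the segment — contradiction. Likewise `im w ∈ im(Γ_ρ)` with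
   horizontal segments (which stay in `ℍ`).
4. `re(g(Q))` is an interval (a preconnected subset of `ℝ`) contained in `re(Γ_ρ)`, so its length
   is `≤ ℓ(ρ) ≤ c`; the same for `im`; hence `‖g z₁ - g z₂‖ ≤ 2c ≤ 8π(1 + C₀)/√(log(1/d))`.

No Brownian motion, harmonic measure or extremal length is used. Mathlib has the measure theory
(`lintegral_image_eq_lintegral_abs_det_fderiv_mul`, `addHaar_image_le_lintegral_abs_det_fderiv`,
`Complex.lintegral_comp_polarCoord_symm`, `Complex.volume_ball`, `circleMap`) but no length–area
statement (searched `length.?area`, `Wolff`, `crosscut`; the tree's `LengthArea.lean` treats the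
unit disc with circles about a boundary point).

## References

* Ch. Pommerenke, *Boundary Behaviour of Conformal Maps*, Springer (1992), Prop. 2.2.
* G. F. Lawler, *Conformally Invariant Processes in the Plane*, AMS (2005), (3.12), Prop. 3.82
  (3.21), Lemma 4.1.
-/

noncomputable section

open Set Filter Metric MeasureTheory Real
open _root_.Complex _root_.Topology
open UpperHalfPlane (upperHalfPlaneSet)
open scoped ENNReal NNReal

namespace Literature.Analysis.Complex

namespace LengthArea

/-! ### The area formula and polar coordinates on an open set, about any centre -/

variable {U : Set ℂ} {f : ℂ → ℂ}

/-- **Area formula** for an injective holomorphic map of an open set: `area (f U) = ∫∫_U ‖f'‖²`. [folklore] -/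
theorem volume_image_eq_lintegral_of_isOpen (hU : IsOpen U) (hf : DifferentiableOn ℂ f U)
    (hinj : InjOn f U) :
    volume (f '' U) = ∫⁻ w in U, ENNReal.ofReal (‖deriv f w‖ ^ 2) := by
  have hd : ∀ w ∈ U, HasFDerivWithinAt f
      ((ContinuousLinearMap.smulRight (1 : ℂ →L[ℂ] ℂ) (deriv f w)).restrictScalars ℝ) U w :=
    fun w hw ↦
    ((hf.differentiableAt (hU.mem_nhds hw)).hasDerivAt.hasFDerivAt.restrictScalars ℝ)
      |>.hasFDerivWithinAt
  have := lintegral_image_eq_lintegral_abs_det_fderiv_mul volume hU.measurableSet hd hinj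
    (fun _ ↦ 1)
  simp only [mul_one, lintegral_one, Measure.restrict_apply_univ] at this
  rw [this]
  refine setLIntegral_congr_fun hU.measurableSet fun w _ ↦ ?_
  rw [det_restrictScalars_smulRight, abs_of_nonneg (by positivity)]

/-- Every point at distance `r` from `p` is `circleMap p r t` for some `t ∈ (-π, π]` (the range of
angles matching `polarCoord.target`; Mathlib's `image_circleMap_Ioc` is over `(0, 2π]`). [folklore] -/
theorem exists_eq_circleMap_of_norm_sub (p : ℂ) {r : ℝ} {z : ℂ} (hz : ‖z - p‖ = r) :
    ∃ t ∈ Ioc (-π) π, z = circleMap p r t := by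
  refine ⟨arg (z - p), arg_mem_Ioc _, ?_⟩
  have h := norm_mul_exp_arg_mul_I (z - p)
  rw [hz] at h
  rw [circleMap, h]
  ring

/-- The speed of `t ↦ circleMap p r t` is `|r|`. [folklore] -/
theorem norm_circleMap_zero_mul_I (r t : ℝ) : ‖circleMap 0 r t * I‖ = |r| := by
  rw [norm_mul, norm_I, mul_one, norm_circleMap_zero]

/-- **Polar coordinates about `p`**: `∫∫ G = ∫_{r > 0} ∫_{t ∈ (-π, π)} r G (p + r e^{it})`, as
an integral over `polarCoord.target = (0, ∞) × (-π, π)`. [folklore] -/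
theorem lintegral_eq_lintegral_polarAt (p : ℂ) (G : ℂ → ℝ≥0∞) :
    ∫⁻ w, G w = ∫⁻ q in polarCoord.target, ENNReal.ofReal q.1 * G (circleMap p q.1 q.2) := by
  rw [← lintegral_add_left_eq_self G p, ← Complex.lintegral_comp_polarCoord_symm]
  simp only [polarCoord_symm_eq, smul_eq_mul, circleMap]

/-- `‖f'‖²` on `U` (extended by `0`), as an `ℝ≥0∞`-valued function (`LengthArea.sqDer` is the
case `U = 𝔻`). [folklore] -/
def sqDerOn (U : Set ℂ) (f : ℂ → ℂ) : ℂ → ℝ≥0∞ :=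
  U.indicator fun w ↦ ENNReal.ofReal (‖deriv f w‖ ^ 2)

/-- `‖f'‖` on `U` (extended by `0`), as an `ℝ≥0∞`-valued function (`LengthArea.der` is the case
`U = 𝔻`). [folklore] -/
def derOn (U : Set ℂ) (f : ℂ → ℂ) : ℂ → ℝ≥0∞ :=
  U.indicator fun w ↦ ENNReal.ofReal ‖deriv f w‖

/-- `derOn U f ^ 2 = sqDerOn U f` pointwise. [folklore] -/
theorem derOn_sq (U : Set ℂ) (f : ℂ → ℂ) (w : ℂ) : derOn U f w ^ 2 = sqDerOn U f w := by
  by_cases hw : w ∈ U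
  · simp [derOn, sqDerOn, hw, ENNReal.ofReal_pow (norm_nonneg _)]
  · simp [derOn, sqDerOn, hw]

/-- `sqDerOn U f` is measurable for open `U`. [folklore] -/
theorem measurable_sqDerOn (hU : IsOpen U) (f : ℂ → ℂ) : Measurable (sqDerOn U f) :=
  (((measurable_deriv f).norm.pow_const 2).ennreal_ofReal).indicator hU.measurableSet

/-- `derOn U f` is measurable for open `U`. [folklore] -/
theorem measurable_derOn (hU : IsOpen U) (f : ℂ → ℂ) : Measurable (derOn U f) :=
  ((measurable_deriv f).norm.ennreal_ofReal).indicator hU.measurableSet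

/-- The angular integral `∫_{-π}^{π} ‖f'(p + r e^{it})‖² dt` (integrand `0` off `U`);
`LengthArea.angSq` is the case `U = 𝔻` with the circles parametrised from a boundary point. [folklore] -/
def angSqAt (U : Set ℂ) (f : ℂ → ℂ) (p : ℂ) (r : ℝ) : ℝ≥0∞ :=
  ∫⁻ t in Ioo (-π) π, sqDerOn U f (circleMap p r t)

/-- The angular integral `∫_{-π}^{π} ‖f'(p + r e^{it})‖ dt` (integrand `0` off `U`); the part of
the circle `{|z - p| = r}` in `U` has image of length `r * angLenAt U f p r`; `LengthArea.angLen`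
is the case `U = 𝔻`. [folklore] -/
def angLenAt (U : Set ℂ) (f : ℂ → ℂ) (p : ℂ) (r : ℝ) : ℝ≥0∞ :=
  ∫⁻ t in Ioo (-π) π, derOn U f (circleMap p r t)

/-- **Area in polar coordinates**: `∫_{r>0} r ∫ ‖f'‖² dt dr = area f(U)` for `f` injective and
holomorphic on the open set `U`. [folklore] -/
theorem lintegral_angSqAt_eq_volume (hU : IsOpen U) (hf : DifferentiableOn ℂ f U)
    (hinj : InjOn f U) (p : ℂ) :
    ∫⁻ r in Ioi (0 : ℝ), ENNReal.ofReal r * angSqAt U f p r = volume (f '' U) := by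
  rw [volume_image_eq_lintegral_of_isOpen hU hf hinj, ← lintegral_indicator hU.measurableSet,
    show (fun w ↦ U.indicator (fun w ↦ ENNReal.ofReal (‖deriv f w‖ ^ 2)) w) = sqDerOn U f from rfl,
    lintegral_eq_lintegral_polarAt p, lintegral_polarCoord_target_eq]
  · refine setLIntegral_congr_fun measurableSet_Ioi fun r _ ↦ ?_
    rw [angSqAt, lintegral_const_mul' _ _ ENNReal.ofReal_ne_top]
  · exact measurable_fst.ennreal_ofReal.mul
      ((measurable_sqDerOn hU f).comp
        (show Continuous fun q : ℝ × ℝ ↦ circleMap p q.1 q.2 by unfold circleMap; fun_prop).measurable)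

/-- **Cauchy–Schwarz** for the angular integrals: `(∫ ‖f'‖ dt)² ≤ 2π ∫ ‖f'‖² dt`. [folklore] -/
theorem angLenAt_sq_le (hU : IsOpen U) (f : ℂ → ℂ) (p : ℂ) (r : ℝ) :
    angLenAt U f p r ^ 2 ≤ ENNReal.ofReal (2 * π) * angSqAt U f p r := by
  set μ : Measure ℝ := volume.restrict (Ioo (-π) π) with hμ
  have hmeas : AEMeasurable (fun t ↦ derOn U f (circleMap p r t)) μ :=
    ((measurable_derOn hU f).comp (continuous_circleMap p r).measurable).aemeasurable
  have h := ENNReal.lintegral_mul_le_Lp_mul_Lq μ Real.HolderConjugate.two_two hmeas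
    (g := fun _ ↦ 1) aemeasurable_const
  simp only [Pi.mul_apply, mul_one, lintegral_const, ENNReal.rpow_two, one_pow, one_mul] at h
  have hvol : μ univ = ENNReal.ofReal (2 * π) := by
    rw [hμ, Measure.restrict_apply_univ, Real.volume_Ioo]; ring_nf
  rw [hvol] at h
  have hsq : ∫⁻ a, derOn U f (circleMap p r a) ^ 2 ∂μ = angSqAt U f p r := by
    simp only [derOn_sq]; rfl
  rw [hsq] at h
  calc angLenAt U f p r ^ 2 = (∫⁻ a, derOn U f (circleMap p r a) ∂μ) ^ 2 := rfl
    _ ≤ (angSqAt U f p r ^ (1 / 2 : ℝ) * ENNReal.ofReal (2 * π) ^ (1 / 2 : ℝ)) ^ 2 := by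
      gcongr
    _ = ENNReal.ofReal (2 * π) * angSqAt U f p r := by
      rw [← ENNReal.mul_rpow_of_nonneg _ _ (by norm_num : (0 : ℝ) ≤ 1 / 2), ← ENNReal.rpow_two,
        ← ENNReal.rpow_mul]
      norm_num [mul_comm]

/-- **Length–area inequality** on an open set: `∫_{r>0} r (∫ ‖f'‖ dt)² dr ≤ 2π · area f(U)`,
i.e. `∫ ℓ(r)² dr / r ≤ 2π A` for the length `ℓ(r)` of the image of the part of the circle
`{|z - p| = r}` inside `U`. Pommerenke, *Boundary Behaviour of Conformal Maps* (1992),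
Prop. 2.2, display (6) (stated there for an arbitrary open set and centre).
[cite: PommerenkeBBCM1992, Prop. 2.2, (6)] -/
theorem lintegral_angLenAt_sq_le (hU : IsOpen U) (hf : DifferentiableOn ℂ f U)
    (hinj : InjOn f U) (p : ℂ) :
    ∫⁻ r in Ioi (0 : ℝ), ENNReal.ofReal r * angLenAt U f p r ^ 2
      ≤ ENNReal.ofReal (2 * π) * volume (f '' U) := by
  calc ∫⁻ r in Ioi (0 : ℝ), ENNReal.ofReal r * angLenAt U f p r ^ 2
      ≤ ∫⁻ r in Ioi (0 : ℝ), ENNReal.ofReal (2 * π) * (ENNReal.ofReal r * angSqAt U f p r) := by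
        refine lintegral_mono fun r ↦ ?_
        rw [mul_left_comm]
        gcongr
        exact angLenAt_sq_le hU f p r
    _ = ENNReal.ofReal (2 * π) * volume (f '' U) := by
        rw [lintegral_const_mul' _ _ ENNReal.ofReal_ne_top, lintegral_angSqAt_eq_volume hU hf hinj p]

/-! ### Pigeonhole on `(d, √d)` -/

/-- **Pigeonhole for the length–area inequality on the scales `(d, √d)`.** If
`∫_{r>0} r Λ(r)² dr ≤ K < ∞` and `0 < d < 1`, then some `r ∈ (d, √d)` has
`r Λ(r) ≤ √(4 (K + 1) / log (1/d))` (on `(d, √d)` one has `∫ dr / r = ½ log (1/d)`;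
Pommerenke (1992), Prop. 2.2, display (4), with an explicit constant).
[cite: PommerenkeBBCM1992, Prop. 2.2, (4)] -/
theorem exists_mem_Ioo_mul_le {Λ : ℝ → ℝ≥0∞} {K : ℝ≥0∞}
    (hK : ∫⁻ r in Ioi (0 : ℝ), ENNReal.ofReal r * Λ r ^ 2 ≤ K) (hKtop : K ≠ ⊤)
    {d : ℝ} (hd : 0 < d) (hd1 : d < 1) :
    ∃ r ∈ Ioo d (√d), ENNReal.ofReal r * Λ r ≤
      ENNReal.ofReal (√(4 * (K.toReal + 1) / Real.log (1 / d))) := by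
  set c : ℝ := √(4 * (K.toReal + 1) / Real.log (1 / d)) with hcdef
  have hlog : 0 < Real.log (1 / d) := Real.log_pos (by rw [lt_div_iff₀ hd]; linarith)
  have hc0 : 0 ≤ c := Real.sqrt_nonneg _
  have hc2 : c ^ 2 * (Real.log (1 / d) / 2) = 2 * (K.toReal + 1) := by
    rw [hcdef, Real.sq_sqrt (by positivity)]
    field_simp
    ring
  by_contra hcon
  push Not at hcon
  have hpt : ∀ r ∈ Ioo d (√d), ENNReal.ofReal (c ^ 2 / r) ≤ ENNReal.ofReal r * Λ r ^ 2 := by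
    intro r hr
    exact ofReal_sq_div_le (hd.trans hr.1) hc0 (hcon r hr).le
  have h1 : ENNReal.ofReal (c ^ 2 * (Real.log (1 / d) / 2)) ≤ K := by
    rw [← lintegral_sq_div c hd hd1]
    calc ∫⁻ r in Ioo d (√d), ENNReal.ofReal (c ^ 2 / r)
        ≤ ∫⁻ r in Ioo d (√d), ENNReal.ofReal r * Λ r ^ 2 := setLIntegral_mono' measurableSet_Ioo hpt
      _ ≤ ∫⁻ r in Ioi (0 : ℝ), ENNReal.ofReal r * Λ r ^ 2 :=
          lintegral_mono_set fun r hr ↦ (hd.trans hr.1 : 0 < r)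
      _ ≤ K := hK
  rw [hc2] at h1
  have h2 : 2 * (K.toReal + 1) ≤ K.toReal := by
    have := ENNReal.toReal_mono hKtop h1
    rwa [ENNReal.toReal_ofReal (by positivity)] at this
  linarith [ENNReal.toReal_nonneg (a := K)]

/-! ### Projections of the image of a circle -/

variable {g : ℂ → ℂ} {p : ℂ} {ρ : ℝ}

/-- The image `Γ_ρ = g(U ∩ {|z - p| = ρ})` is covered by the parametrised image of the angles
`t ∈ (-π, π]` with `p + ρe^{it} ∈ U`. [folklore] -/
theorem image_inter_sphere_subset :
    g '' (U ∩ sphere p ρ) ⊆ (fun t ↦ g (circleMap p ρ t)) '' {t ∈ Ioc (-π) π | circleMap p ρ t ∈ U} := by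
  rintro _ ⟨z, ⟨hzU, hz⟩, rfl⟩
  obtain ⟨t, ht, rfl⟩ := exists_eq_circleMap_of_norm_sub p (mem_sphere_iff_norm.1 hz)
  exact ⟨t, ⟨ht, hzU⟩, rfl⟩

/-- The set of angles `t ∈ (-π, π]` with `p + ρe^{it} ∈ U` is measurable (`U` open). [folklore] -/
theorem measurableSet_angles (hU : IsOpen U) (p : ℂ) (ρ : ℝ) :
    MeasurableSet {t ∈ Ioc (-π) π | circleMap p ρ t ∈ U} :=
  measurableSet_Ioc.inter (hU.preimage (continuous_circleMap p ρ)).measurableSet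

/-- **The projection of `Γ_ρ` to a line has measure at most the length of `Γ_ρ`**: for a real
linear functional `L` of norm `≤ 1` (below: `re` and `im`),
`volume (L(Γ_ρ)) ≤ ρ ∫ ‖g'(p + ρe^{it})‖ dt` (change of variables inequality for the real function
`t ↦ L (g (p + ρ e^{it}))`). [folklore] -/
theorem volume_image_image_le (hU : IsOpen U) (hg : DifferentiableOn ℂ g U) (hρ : 0 < ρ)
    (L : ℂ →L[ℝ] ℝ) (hL : ∀ z, |L z| ≤ ‖z‖) :
    volume (L '' (g '' (U ∩ sphere p ρ))) ≤ ENNReal.ofReal ρ * angLenAt U g p ρ := by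
  set O : Set ℝ := {t ∈ Ioc (-π) π | circleMap p ρ t ∈ U} with hO
  set F : ℝ → ℝ := fun t ↦ L (g (circleMap p ρ t)) with hF
  set F' : ℝ → ℝ := fun t ↦ L (deriv g (circleMap p ρ t) * (circleMap 0 ρ t * I)) with hF'
  have hderiv : ∀ t ∈ O, HasDerivAt F (F' t) t := fun t ht ↦ by
    have h1 : HasDerivAt (fun s ↦ g (circleMap p ρ s)) (deriv g (circleMap p ρ t) * (circleMap 0 ρ t * I)) t :=
      (hg.differentiableAt (hU.mem_nhds ht.2)).hasDerivAt.comp t (hasDerivAt_circleMap p ρ t)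
    exact L.hasFDerivAt.comp_hasDerivAt t h1
  have hsub : L '' (g '' (U ∩ sphere p ρ)) ⊆ F '' O := by
    refine (image_mono image_inter_sphere_subset).trans ?_
    rintro _ ⟨_, ⟨t, ht, rfl⟩, rfl⟩
    exact ⟨t, ht, rfl⟩
  calc volume (L '' (g '' (U ∩ sphere p ρ))) ≤ volume (F '' O) := measure_mono hsub
    _ ≤ ∫⁻ t in O, ENNReal.ofReal |(ContinuousLinearMap.toSpanSingleton ℝ (F' t)).det| :=
        addHaar_image_le_lintegral_abs_det_fderiv volume (measurableSet_angles hU p ρ)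
          fun t ht ↦ (hderiv t ht).hasDerivWithinAt.hasFDerivWithinAt
    _ ≤ ∫⁻ t in O, derOn U g (circleMap p ρ t) * ENNReal.ofReal ρ := by
        refine setLIntegral_mono' (measurableSet_angles hU p ρ) fun t ht ↦ ?_
        rw [ContinuousLinearMap.det_toSpanSingleton, derOn, indicator_of_mem ht.2,
          ← ENNReal.ofReal_mul (norm_nonneg _)]
        refine ENNReal.ofReal_le_ofReal ?_
        calc |F' t| ≤ ‖deriv g (circleMap p ρ t) * (circleMap 0 ρ t * I)‖ := hL _
          _ = ‖deriv g (circleMap p ρ t)‖ * ρ := by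
              rw [norm_mul, norm_circleMap_zero_mul_I, abs_of_pos hρ]
    _ = (∫⁻ t in O, derOn U g (circleMap p ρ t)) * ENNReal.ofReal ρ :=
        lintegral_mul_const' _ _ ENNReal.ofReal_ne_top
    _ ≤ (∫⁻ t in Ioc (-π) π, derOn U g (circleMap p ρ t)) * ENNReal.ofReal ρ := by
        gcongr
        exact fun t ht ↦ ht.1
    _ = ENNReal.ofReal ρ * angLenAt U g p ρ := by
        rw [mul_comm, angLenAt, setLIntegral_congr Ioo_ae_eq_Ioc]

/-! ### The projection trick -/

section Trick

variable {f : ℂ → ℂ} {C₀ : ℝ}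
  (hgU : MapsTo g U upperHalfPlaneSet) (hfU : MapsTo f upperHalfPlaneSet U)
  (hfc : ContinuousOn f upperHalfPlaneSet) (hgf : ∀ w ∈ upperHalfPlaneSet, g (f w) = w)
  (hfg : ∀ z ∈ U, f (g z) = z) (hC : ∀ z ∈ U, ‖g z - z‖ ≤ C₀)
include hgU hfU hfc hgf hfg hC

omit hgU hfc hfg in
/-- The inverse map also moves points by at most `C₀`. [folklore] -/
theorem norm_inverse_sub_le {w : ℂ} (hw : w ∈ upperHalfPlaneSet) : ‖f w - w‖ ≤ C₀ := by
  have h := hC (f w) (hfU hw)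
  rwa [hgf w hw, norm_sub_rev] at h

omit hgU hfg in
/-- **Crossing lemma**: a segment `s ↦ w + s v` (`s ∈ [0, H]`, `H` large) which stays in `ℍ` is
pulled back by `f` to a path from `f w ∈ B(p, ρ)` to a point outside `B̄(p, ρ)`, so some point
`w + s v` of it is the `g`-image of a point of `U ∩ {|z - p| = ρ}`. [folklore] -/
theorem exists_mem_image_inter_sphere {w v : ℂ} (hv : ‖v‖ = 1)
    (hray : ∀ s : ℝ, 0 ≤ s → w + s * v ∈ upperHalfPlaneSet) (hρ1 : ρ < 1)
    (hw : ‖f w - p‖ < ρ) :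
    ∃ s : ℝ, 0 ≤ s ∧ w + s * v ∈ g '' (U ∩ sphere p ρ) := by
  set H : ℝ := ‖w‖ + ‖p‖ + C₀ + 2 with hH
  have hC0 : 0 ≤ C₀ := (norm_nonneg _).trans (hC (f w) (hfU (by simpa using hray 0 le_rfl)))
  have hH0 : 0 ≤ H := by positivity
  set h : ℝ → ℝ := fun s ↦ ‖f (w + s * v) - p‖ with hh
  have hcont : ContinuousOn h (Icc 0 H) := by
    have h1 : ContinuousOn (fun s : ℝ ↦ f (w + s * v)) (Icc 0 H) :=
      hfc.comp (by fun_prop) fun s hs ↦ hray s hs.1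
    exact (h1.sub continuousOn_const).norm
  have h0 : h 0 ≤ ρ := by simp only [hh, ofReal_zero, zero_mul, add_zero]; exact hw.le
  have hHρ : ρ ≤ h H := by
    set x : ℂ := w + H * v with hx
    have hfar : ‖f x - x‖ ≤ C₀ := norm_inverse_sub_le hfU hgf hC (hray H hH0)
    have hHv : ‖(H : ℂ) * v‖ = H := by
      rw [norm_mul, hv, mul_one, Complex.norm_real, Real.norm_eq_abs, abs_of_nonneg hH0]
    have h1 : H ≤ ‖x - p‖ + ‖w‖ + ‖p‖ := by
      calc H = ‖(H : ℂ) * v‖ := hHv.symm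
        _ = ‖(x - p) - (w - p)‖ := by rw [hx]; ring_nf
        _ ≤ ‖x - p‖ + ‖w - p‖ := norm_sub_le _ _
        _ ≤ ‖x - p‖ + (‖w‖ + ‖p‖) := by gcongr; exact norm_sub_le w p
        _ = ‖x - p‖ + ‖w‖ + ‖p‖ := by ring
    have h2 : ‖x - p‖ ≤ ‖f x - p‖ + ‖f x - x‖ := by
      calc ‖x - p‖ = ‖(f x - p) - (f x - x)‖ := by
            rw [show f x - p - (f x - x) = x - p by ring]
        _ ≤ ‖f x - p‖ + ‖f x - x‖ := norm_sub_le _ _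
    have h3 : H - ‖w‖ - ‖p‖ - C₀ = 2 := by rw [hH]; ring
    show ρ ≤ ‖f x - p‖
    linarith
  obtain ⟨s, hs, hsρ⟩ := intermediate_value_Icc hH0 hcont ⟨h0, hHρ⟩
  refine ⟨s, hs.1, f (w + s * v), ⟨hfU (hray s hs.1), ?_⟩, hgf _ (hray s hs.1)⟩
  exact mem_sphere_iff_norm.2 hsρ

/-- **`re w ∈ re(Γ_ρ)` for every `w ∈ g(U ∩ B(p, ρ))`** (vertical segments from `w` stay in `ℍ`
and have constant real part). [folklore] -/
theorem re_mem_image_of_mem (hρ1 : ρ < 1) {q : ℂ} (hqU : q ∈ U) (hq : ‖q - p‖ < ρ) :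
    (g q).re ∈ re '' (g '' (U ∩ sphere p ρ)) := by
  have hw : g q ∈ upperHalfPlaneSet := hgU hqU
  have hray : ∀ s : ℝ, 0 ≤ s → g q + s * I ∈ upperHalfPlaneSet := fun s hs ↦ by
    show 0 < (g q + s * I).im
    have : 0 < (g q).im := hw
    simp only [add_im, mul_im, ofReal_re, I_im, mul_one, ofReal_im, I_re, mul_zero, add_zero]
    linarith
  obtain ⟨s, -, hs⟩ := exists_mem_image_inter_sphere hfU hfc hgf hC (by simp) hray hρ1
    (by rwa [hfg q hqU])
  exact ⟨_, hs, by simp⟩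

/-- **`im w ∈ im(Γ_ρ)` for every `w ∈ g(U ∩ B(p, ρ))`** (horizontal segments from `w` stay in
`ℍ` and have constant imaginary part). [folklore] -/
theorem im_mem_image_of_mem (hρ1 : ρ < 1) {q : ℂ} (hqU : q ∈ U) (hq : ‖q - p‖ < ρ) :
    (g q).im ∈ im '' (g '' (U ∩ sphere p ρ)) := by
  have hw : g q ∈ upperHalfPlaneSet := hgU hqU
  have hray : ∀ s : ℝ, 0 ≤ s → g q + s * (1 : ℂ) ∈ upperHalfPlaneSet := fun s _ ↦ by
    show 0 < (g q + s * 1).im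
    have : 0 < (g q).im := hw
    simpa using this
  obtain ⟨s, -, hs⟩ := exists_mem_image_inter_sphere hfU hfc hgf hC (by simp) hray hρ1
    (by rwa [hfg q hqU])
  exact ⟨_, hs, by simp⟩

end Trick

/-! ### The modulus of continuity -/

/-- An interval of reals contained in a set of measure `≤ c` has length `≤ c`. [folklore] -/
theorem abs_sub_le_of_ordConnected {S T : Set ℝ} (hS : S.OrdConnected) (hST : S ⊆ T) {c : ℝ}
    (hc : 0 ≤ c) (hT : volume T ≤ ENNReal.ofReal c) {a b : ℝ} (ha : a ∈ S) (hb : b ∈ S) :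
    |a - b| ≤ c := by
  have hsub : uIcc a b ⊆ T := (hS.uIcc_subset ha hb).trans hST
  have h := (measure_mono hsub).trans hT
  rw [Real.volume_interval, ENNReal.ofReal_le_ofReal_iff hc, abs_sub_comm] at h
  exact h

/-- **Uniform modulus of continuity of a conformal map onto the half-plane which moves points
boundedly.** Let `U ⊆ ℂ` be open, `g` holomorphic and injective on `U` with `g(U) ⊆ ℍ`, and
`f : ℍ → U` a continuous inverse (`g ∘ f = id` on `ℍ`, `f ∘ g = id` on `U`), with
`‖g z - z‖ ≤ C₀` on `U`. Then for every preconnected `Q ⊆ U ∩ B(p, d)` with `0 < d < 1` and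
all `z₁, z₂ ∈ Q`: `‖g z₁ - g z₂‖ ≤ 8π (1 + C₀) / √(log (1/d))`. (Length–area on the circles
`{|z - p| = ρ}`, `d < ρ < √d`, and the projection trick of the module docstring; a substitute for
Lawler (2005), (3.21), for the half-plane maps `g_A`.) [folklore] -/
theorem norm_sub_le_of_isPreconnected (hU : IsOpen U) (hg : DifferentiableOn ℂ g U)
    {f : ℂ → ℂ} (hgU : MapsTo g U upperHalfPlaneSet)
    (hfU : MapsTo f upperHalfPlaneSet U) (hfc : ContinuousOn f upperHalfPlaneSet)
    (hgf : ∀ w ∈ upperHalfPlaneSet, g (f w) = w) (hfg : ∀ z ∈ U, f (g z) = z)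
    {C₀ : ℝ} (hC : ∀ z ∈ U, ‖g z - z‖ ≤ C₀)
    {d : ℝ} (hd : 0 < d) (hd1 : d < 1) {Q : Set ℂ} (hQ : IsPreconnected Q) (hQU : Q ⊆ U)
    (hQd : Q ⊆ ball p d) {z₁ z₂ : ℂ} (hz₁ : z₁ ∈ Q) (hz₂ : z₂ ∈ Q) :
    ‖g z₁ - g z₂‖ ≤ 8 * π * (1 + C₀) / √(Real.log (1 / d)) := by
  -- injectivity of `g` and `0 ≤ C₀` come for free
  have hinj : InjOn g U := fun a ha b hb hab ↦ by rw [← hfg a ha, ← hfg b hb, hab]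
  have hC₀ : 0 ≤ C₀ := (norm_nonneg _).trans (hC z₁ (hQU hz₁))
  -- the local open set `U' = U ∩ B(p, 1)` and the area of its image
  set U' : Set ℂ := U ∩ ball p 1 with hU'
  have hU'o : IsOpen U' := hU.inter isOpen_ball
  have hg' : DifferentiableOn ℂ g U' := hg.mono inter_subset_left
  have hinj' : InjOn g U' := hinj.mono inter_subset_left
  have himg : g '' U' ⊆ ball p (1 + C₀) := by
    rintro _ ⟨z, ⟨hzU, hz⟩, rfl⟩
    rw [mem_ball, dist_eq_norm] at hz ⊢
    calc ‖g z - p‖ = ‖(g z - z) + (z - p)‖ := by ring_nf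
      _ ≤ ‖g z - z‖ + ‖z - p‖ := norm_add_le _ _
      _ < C₀ + 1 := add_lt_add_of_le_of_lt (hC z hzU) hz
      _ = 1 + C₀ := add_comm _ _
  have hvol : volume (g '' U') ≤ ENNReal.ofReal ((1 + C₀) ^ 2 * π) := by
    refine (measure_mono himg).trans (le_of_eq ?_)
    rw [Complex.volume_ball, ENNReal.ofReal_mul (by positivity), ← ENNReal.ofReal_pow (by positivity),
      ← NNReal.coe_real_pi, ENNReal.ofReal_coe_nnreal]
  set K : ℝ≥0∞ := ENNReal.ofReal (2 * π) * ENNReal.ofReal ((1 + C₀) ^ 2 * π) with hKdef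
  have hKtop : K ≠ ⊤ := ENNReal.mul_ne_top ENNReal.ofReal_ne_top ENNReal.ofReal_ne_top
  have hKreal : K.toReal = 2 * π * ((1 + C₀) ^ 2 * π) := by
    rw [hKdef, ENNReal.toReal_mul, ENNReal.toReal_ofReal (by positivity),
      ENNReal.toReal_ofReal (by positivity)]
  have hLA : ∫⁻ r in Ioi (0 : ℝ), ENNReal.ofReal r * angLenAt U' g p r ^ 2 ≤ K :=
    (lintegral_angLenAt_sq_le hU'o hg' hinj' p).trans (by rw [hKdef]; gcongr)
  -- the good radius
  obtain ⟨ρ, ⟨hdρ, hρd⟩, hρ⟩ := exists_mem_Ioo_mul_le hLA hKtop hd hd1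
  set c : ℝ := √(4 * (K.toReal + 1) / Real.log (1 / d)) with hcdef
  have hc0 : 0 ≤ c := Real.sqrt_nonneg _
  have hρ0 : 0 < ρ := hd.trans hdρ
  have hρ1 : ρ < 1 := hρd.trans ((Real.sqrt_lt' one_pos).2 (by simpa using hd1))
  -- the projections of `Γ_ρ` have measure `≤ c`
  have hsph : U ∩ sphere p ρ = U' ∩ sphere p ρ := by
    ext z
    simp only [hU', mem_inter_iff, mem_sphere, mem_ball]
    constructor
    · rintro ⟨hzU, hz⟩; exact ⟨⟨hzU, by rw [hz]; exact hρ1⟩, hz⟩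
    · rintro ⟨⟨hzU, -⟩, hz⟩; exact ⟨hzU, hz⟩
  have hre : volume (re '' (g '' (U ∩ sphere p ρ))) ≤ ENNReal.ofReal c := by
    rw [hsph]
    refine (volume_image_image_le hU'o hg' hρ0 reCLM fun z ↦ ?_).trans hρ
    simpa using abs_re_le_norm z
  have him : volume (im '' (g '' (U ∩ sphere p ρ))) ≤ ENNReal.ofReal c := by
    rw [hsph]
    refine (volume_image_image_le hU'o hg' hρ0 imCLM fun z ↦ ?_).trans hρ
    simpa using abs_im_le_norm z
  -- the projections of `g(Q)` are intervals inside those of `Γ_ρ`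
  have hcont : ContinuousOn g Q := hg.continuousOn.mono hQU
  have hQρ : ∀ q ∈ Q, ‖q - p‖ < ρ := fun q hq ↦ by
    have := hQd hq
    rw [mem_ball, dist_eq_norm] at this
    exact this.trans hdρ
  have hreS : (re '' (g '' Q)).OrdConnected := by
    rw [← image_comp]
    exact ((hQ.image _ (continuous_re.comp_continuousOn hcont))).ordConnected
  have himS : (im '' (g '' Q)).OrdConnected := by
    rw [← image_comp]
    exact ((hQ.image _ (continuous_im.comp_continuousOn hcont))).ordConnected
  have hreT : re '' (g '' Q) ⊆ re '' (g '' (U ∩ sphere p ρ)) := by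
    rintro _ ⟨_, ⟨q, hq, rfl⟩, rfl⟩
    exact re_mem_image_of_mem hgU hfU hfc hgf hfg hC hρ1 (hQU hq) (hQρ q hq)
  have himT : im '' (g '' Q) ⊆ im '' (g '' (U ∩ sphere p ρ)) := by
    rintro _ ⟨_, ⟨q, hq, rfl⟩, rfl⟩
    exact im_mem_image_of_mem hgU hfU hfc hgf hfg hC hρ1 (hQU hq) (hQρ q hq)
  have h1 : |(g z₁).re - (g z₂).re| ≤ c :=
    abs_sub_le_of_ordConnected hreS hreT hc0 hre ⟨g z₁, ⟨z₁, hz₁, rfl⟩, rfl⟩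
      ⟨g z₂, ⟨z₂, hz₂, rfl⟩, rfl⟩
  have h2 : |(g z₁).im - (g z₂).im| ≤ c :=
    abs_sub_le_of_ordConnected himS himT hc0 him ⟨g z₁, ⟨z₁, hz₁, rfl⟩, rfl⟩
      ⟨g z₂, ⟨z₂, hz₂, rfl⟩, rfl⟩
  -- `2c ≤ 8π(1 + C₀)/√(log(1/d))`
  have hlog : 0 < Real.log (1 / d) := Real.log_pos (by rw [lt_div_iff₀ hd]; linarith)
  have hc_le : c ≤ 4 * π * (1 + C₀) / √(Real.log (1 / d)) := by
    rw [hcdef, hKreal, Real.sqrt_div' _ hlog.le, div_le_div_iff_of_pos_right (Real.sqrt_pos.2 hlog)]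
    have hπ : (2 : ℝ) ≤ π := Real.two_le_pi
    have hC1 : (1 : ℝ) ≤ (1 + C₀) ^ 2 := by nlinarith
    have hπ2 : (4 : ℝ) ≤ π ^ 2 := by nlinarith
    have hkey : 4 * (2 * π * ((1 + C₀) ^ 2 * π) + 1) ≤ (4 * π * (1 + C₀)) ^ 2 := by
      nlinarith [mul_le_mul hπ2 hC1 (by norm_num) (by positivity)]
    calc √(4 * (2 * π * ((1 + C₀) ^ 2 * π) + 1)) ≤ √((4 * π * (1 + C₀)) ^ 2) :=
          Real.sqrt_le_sqrt hkey
      _ = 4 * π * (1 + C₀) := Real.sqrt_sq (by positivity)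
  calc ‖g z₁ - g z₂‖ ≤ |(g z₁ - g z₂).re| + |(g z₁ - g z₂).im| := norm_le_abs_re_add_abs_im _
    _ = |(g z₁).re - (g z₂).re| + |(g z₁).im - (g z₂).im| := by simp
    _ ≤ c + c := add_le_add h1 h2
    _ ≤ 4 * π * (1 + C₀) / √(Real.log (1 / d)) + 4 * π * (1 + C₀) / √(Real.log (1 / d)) :=
        add_le_add hc_le hc_le
    _ = 8 * π * (1 + C₀) / √(Real.log (1 / d)) := by ring

end LengthArea

end Literature.Analysis.Complex
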